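import Literature.Barriers.RiemannHypothesis.TuranPartialSumsShiftLowCheck
import Literature.Barriers.RiemannHypothesis.TuranPartialSumsShiftCheckSound
import Literature.Barriers.RiemannHypothesis.TuranPartialSumsCriterion
import HarnessLib

/-!
# Sections of `ζ` beyond `σ = 1`: the vertical-shift construction below `N = 360000` — soundness of the block checker

Barrier catalogue `Literature/Barriers/RiemannHypothesis/`, companion of
`TuranPartialSumsShiftLowCheck.lean`. Main result: `exists_zero_of_checkBlks` — if
`checkBlks H bs = true` then for every block `b ∈ bs` and every `N ∈ [b.lo, b.hi]` the section
`ζ_N(s) = ∑_{n ≤ N} n^{-s}` has a zero with `Re s > 1`.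

For a block `(P, Q, a, lo, hi)` (consecutive primes `P < Q`, `P² ≤ lo ≤ hi < Q²`) the phases
`ω(p) = p^{-iτ}`, `τ = a/1000`, are put on `S = {p ≤ P prime}`; then `S ⊇ {p : p² ≤ N}` for every
`N ≤ hi` and the criterion `exists_zero_of_criterion` applies with `B(N) = smoothSum N S ω 1` and the
coefficients `c_p(1) = S(⌊N/p⌋)/p` on the free primes `P < p ≤ N`. The file proves: the
identification `B(N) = S(N) − ∑_{P<p≤N} p^{-s} S(N/p)` (`twistedPartialSum_decomposition`), the
`1/(N+1)`-Lipschitz behaviour of `‖B‖` and `R = ∑ ‖c_p‖` along the block, the side bound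
`‖c_p‖ ≤ (1 + log Q)/Q`, and the inclusion property of every integer the checker computes (table of
`S(m)`, Euler–Maclaurin enclosure of `S(N)` through `powSum_eq_powInt_add`, `norm_emConst_sub_le`,
`norm_emTail_le`, the prime sums, the step rule).

## References

* [PlattTrudgian2016] D. J. Platt, T. S. Trudgian, *Zeroes of partial sums of the zeta-function*,
  LMS J. Comput. Math. 19 (2016), §2.2 (the criterion, as formalized in
  `TuranPartialSumsCriterion.lean`). The construction is the tree's.
* R. E. Moore, *Interval Analysis* (1966), Ch. 3–4. [folklore]
-/

noncomputable section

open Real Complex Finset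
open Literature.Analysis.ValidatedNumerics.NumericsMP
open Literature.Analysis.ValidatedNumerics (Numerics.cdiv Numerics.div_le_cdiv Numerics.fdiv_le_div
  Numerics.le_cdiv_mul_real Numerics.fdiv_mul_le_real)

namespace Literature.Barriers.RiemannHypothesis

namespace TuranShift

namespace LowCert

open Cert (S KE kE KL KP normHi normLo expNegI S_pos S_posR S_neR S_posZ mem_expNegI norm_le_normHi
  normLo_le_norm le_cdiv_of_mul_le le_cdiv_of_le_div fdiv_le_of_le_mul le_maxhi_of_mem)

/-! ## The objects of the criterion for a general shift `τ` and prime bound `P` -/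

/-- The phases `ω(p) = p^{-iτ}`. [folklore] -/
def omegaT (τ : ℝ) (p : ℕ) : ℂ := npow (τ * I) p

/-- The fixed set `S = {p ≤ P prime}`. [folklore] -/
def Sset (P : ℕ) : Finset ℕ := (Finset.Icc 1 P).filter Nat.Prime

/-- `B(N)`: the smooth sum of the criterion. [folklore] -/
def BT (τ : ℝ) (P N : ℕ) : ℂ := smoothSum N (Sset P) (omegaT τ) 1

/-- `R(N) = ∑_{p free} ‖c_p(1)‖`. [folklore] -/
def RT (τ : ℝ) (P N : ℕ) : ℝ := ∑ p ∈ freePrimes N (Sset P), ‖bigCoeff N (omegaT τ) p 1‖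

/-- The shift of a block: `τ = a/1000`. [folklore] -/
def tauB (a : ℕ) : ℝ := (a : ℝ) / 1000

/-- `s = 1 + iτ`. [folklore] -/
def sB (a : ℕ) : ℂ := 1 + tauB a * I

/-- [folklore] -/
theorem sB_re (a : ℕ) : (sB a).re = 1 := by simp [sB]

/-- [folklore] -/
theorem sB_sub_one (a : ℕ) : sB a - 1 = tauB a * I := by simp [sB]

/-- [folklore] -/
theorem tauB_pos {a : ℕ} (ha : 0 < a) : 0 < tauB a := by
  unfold tauB; exact div_pos (by exact_mod_cast ha) (by norm_num)

/-- [folklore] -/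
theorem sB_ne_one {a : ℕ} (ha : 0 < a) : sB a ≠ 1 := by
  intro h
  have := congrArg Complex.im h
  simp [sB] at this
  exact (tauB_pos ha).ne' this

/-- `‖s(s+1)‖ ≤ 4` for `τ ≤ 1.1`. [folklore] -/
theorem norm_sB_mul_le {a : ℕ} (ha : a ≤ 1100) : ‖sB a * (sB a + 1)‖ ≤ 4 := by
  have hτ : tauB a ≤ 1.1 := by
    unfold tauB; rw [div_le_iff₀ (by norm_num)]
    have : (a : ℝ) ≤ 1100 := by exact_mod_cast ha
    linarith
  have hτ0 : 0 ≤ tauB a := by unfold tauB; positivity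
  have h1 : ‖sB a‖ ≤ 1.5 := by
    have e : ‖sB a‖ ^ 2 = 1 + tauB a ^ 2 := by
      rw [sB, Complex.sq_norm, Complex.normSq_apply]; simp; ring
    nlinarith [norm_nonneg (sB a)]
  have h2 : ‖sB a + 1‖ ≤ 2.5 := by
    have e : ‖sB a + 1‖ ^ 2 = 4 + tauB a ^ 2 := by
      rw [sB, Complex.sq_norm, Complex.normSq_apply]; simp; ring
    nlinarith [norm_nonneg (sB a + 1)]
  rw [norm_mul]
  nlinarith [norm_nonneg (sB a), norm_nonneg (sB a + 1)]

/-- The phases are unimodular. [folklore] -/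
theorem norm_omegaT (τ : ℝ) {p : ℕ} (hp : 0 < p) : ‖omegaT τ p‖ = 1 :=
  norm_npow_mul_I _ (by exact_mod_cast hp)

/-- `complMul ω n = n^{-iτ}` for `n ≥ 1` (complete multiplicativity of `npow`). [folklore] -/
theorem complMul_omegaT (τ : ℝ) {n : ℕ} (hn : 0 < n) : complMul (omegaT τ) n = npow (τ * I) n := by
  induction n using Nat.recOnPosPrimePosCoprime with
  | prime_pow p k hp hk =>
    rw [complMul_prime_pow _ hp, omegaT]
    have hp0 : (0 : ℝ) < p := by exact_mod_cast hp.pos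
    push_cast
    rw [npow, npow, ← Complex.exp_nat_mul, Real.log_pow]
    push_cast
    ring_nf
  | zero => omega
  | one => simp [npow]
  | coprime a b ha hb _ iha ihb =>
    rw [map_mul, iha (by omega), ihb (by omega)]
    push_cast
    rw [npow_mul _ (by exact_mod_cast (show 0 < a by omega)) (by exact_mod_cast (show 0 < b by omega))]

/-- The summands at `σ = 1`: `a_ω(k) k^{-1} = npow s k`. [folklore] -/
theorem complMul_mul_cpow_T (τ : ℝ) {k : ℕ} (hk : 0 < k) :
    complMul (omegaT τ) k * (k : ℂ) ^ (-(((1 : ℝ)) : ℂ)) = npow (1 + τ * I) k := by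
  rw [complMul_omegaT τ hk, npow_one_add _ (by exact_mod_cast hk)]
  push_cast
  rw [Complex.cpow_neg_one]

/-- The big coefficient at `σ = 1`: `c_p(1) = S(N/p)/p`. [folklore] -/
theorem bigCoeff_T (τ : ℝ) (N : ℕ) {p : ℕ} (hp : 0 < p) :
    bigCoeff N (omegaT τ) p 1 = (((p : ℝ)⁻¹ : ℝ) : ℂ) * powSum (1 + τ * I) (N / p) := by
  unfold bigCoeff powSum
  rw [Finset.mul_sum]
  refine Finset.sum_congr rfl fun m hm ↦ ?_
  have hm0 : 0 < m := (Finset.mem_Icc.1 hm).1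
  rw [complMul_omegaT τ hm0, npow_one_add _ (by exact_mod_cast hm0)]
  push_cast
  rw [Complex.cpow_neg_one]
  have hp' : (p : ℂ) ≠ 0 := by exact_mod_cast hp.ne'
  have hm' : (m : ℂ) ≠ 0 := by exact_mod_cast hm0.ne'
  field_simp

/-- `‖c_p(1)‖ = ‖S(N/p)‖/p`. [folklore] -/
theorem norm_bigCoeff_T (τ : ℝ) (N : ℕ) {p : ℕ} (hp : 0 < p) :
    ‖bigCoeff N (omegaT τ) p 1‖ = ‖powSum (1 + τ * I) (N / p)‖ / p := by
  rw [bigCoeff_T τ N hp, norm_mul, Complex.norm_real, Real.norm_eq_abs,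
    abs_of_pos (inv_pos.2 (by exact_mod_cast hp))]
  ring

/-- `ω(p) c_p(1) = p^{-s} S(N/p)`. [folklore] -/
theorem omegaT_mul_bigCoeff (τ : ℝ) (N : ℕ) {p : ℕ} (hp : 0 < p) :
    omegaT τ p * bigCoeff N (omegaT τ) p 1 = npow (1 + τ * I) p * powSum (1 + τ * I) (N / p) := by
  rw [bigCoeff_T τ N hp, omegaT, npow_one_add _ (by exact_mod_cast hp)]
  ring

/-- Membership in the free primes of `S = {p ≤ P}`. [folklore] -/
theorem mem_freePrimes_Sset {P N p : ℕ} : p ∈ freePrimes N (Sset P) ↔ p.Prime ∧ P < p ∧ p ≤ N := by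
  rw [mem_freePrimes]
  simp only [Sset, Finset.mem_filter, Finset.mem_Icc, not_and]
  constructor
  · rintro ⟨⟨h1, h2⟩, hp, h3⟩
    refine ⟨hp, ?_, h2⟩
    by_contra h
    exact h3 ⟨h1, not_lt.1 h⟩ hp
  · rintro ⟨hp, h1, h2⟩
    exact ⟨⟨hp.one_lt.le, h2⟩, hp, fun h ↦ absurd h.2 (not_le.2 h1)⟩

/-- **`S ⊇ {p : p² ≤ N}`** on a block: if no prime lies strictly between `P` and `Q` and `N < Q²`,
every prime `p` with `p² ≤ N` is `≤ P`. [folklore] -/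
theorem hSall_of_block {P Q N : ℕ} (hnb : ∀ r, P < r → r < Q → ¬ r.Prime) (hN : N < Q * Q) :
    ∀ p : ℕ, p.Prime → p * p ≤ N → p ∈ Sset P := by
  intro p hp hpp
  have hpQ : p < Q := by
    by_contra h
    have hQp : Q ≤ p := not_lt.1 h
    have : Q * Q ≤ p * p := Nat.mul_le_mul hQp hQp
    omega
  have hpP : p ≤ P := by
    by_contra h
    exact hnb p (not_le.1 h) hpQ hp
  exact Finset.mem_filter.2 ⟨Finset.mem_Icc.2 ⟨hp.one_lt.le, hpP⟩, hp⟩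

/-- A free prime on a block is `≥ Q`. [folklore] -/
theorem Q_le_of_free {P Q N p : ℕ} (hnb : ∀ r, P < r → r < Q → ¬ r.Prime)
    (hp : p ∈ freePrimes N (Sset P)) : Q ≤ p := by
  obtain ⟨hpr, hPp, _⟩ := mem_freePrimes_Sset.1 hp
  by_contra h
  exact hnb p hPp (not_le.1 h) hpr

/-- **`B(N)` in analytic form**: `B(N) = S(N) − ∑_{P<p≤N} p^{-s} S(N/p)`. [folklore] -/
theorem BT_eq (τ : ℝ) {P Q N : ℕ} (hnb : ∀ r, P < r → r < Q → ¬ r.Prime) (hN : N < Q * Q) :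
    BT τ P N = powSum (1 + τ * I) N -
      ∑ p ∈ freePrimes N (Sset P), npow (1 + τ * I) p * powSum (1 + τ * I) (N / p) := by
  have hSall := hSall_of_block hnb hN
  have hdec := twistedPartialSum_decomposition hSall (ω := omegaT τ) (φ := omegaT τ)
    (fun p _ ↦ rfl) (((1 : ℝ)) : ℂ) N le_rfl
  have hL : ∑ k ∈ Finset.Icc 1 N, complMul (omegaT τ) k * (k : ℂ) ^ (-(((1 : ℝ)) : ℂ)) = powSum (1 + τ * I) N := by
    unfold powSum
    exact Finset.sum_congr rfl fun k hk ↦ complMul_mul_cpow_T τ (Finset.mem_Icc.1 hk).1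
  have hF : ∑ r ∈ freePrimes N (Sset P), omegaT τ r *
      ∑ m ∈ Finset.Icc 1 (N / r), complMul (omegaT τ) m * ((m * r : ℕ) : ℂ) ^ (-(((1 : ℝ)) : ℂ)) =
      ∑ p ∈ freePrimes N (Sset P), npow (1 + τ * I) p * powSum (1 + τ * I) (N / p) := by
    refine Finset.sum_congr rfl fun p hp ↦ ?_
    have hp0 : 0 < p := (mem_freePrimes_Sset.1 hp).1.pos
    have := omegaT_mul_bigCoeff τ N hp0
    unfold bigCoeff at this
    exact this
  rw [hL, hF] at hdec
  unfold BT smoothSum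
  rw [eq_sub_iff_add_eq]
  exact hdec.symm

/-- **`R(N)` in analytic form.** [folklore] -/
theorem RT_eq (τ : ℝ) (P N : ℕ) :
    RT τ P N = ∑ p ∈ freePrimes N (Sset P), ‖powSum (1 + τ * I) (N / p)‖ / p := by
  unfold RT
  refine Finset.sum_congr rfl fun p hp ↦ ?_
  rw [norm_bigCoeff_T τ N (mem_freePrimes_Sset.1 hp).1.pos]

/-! ## Lipschitz behaviour along a block -/

/-- One step of the smooth sum: `‖B(n+1)‖ ≤ ‖B(n)‖ + 1/(n+1)`. [folklore] -/
theorem norm_BT_succ_le (τ : ℝ) (P n : ℕ) : ‖BT τ P (n + 1)‖ ≤ ‖BT τ P n‖ + 1 / (n + 1) := by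
  unfold BT smoothSum
  rw [← Finset.insert_Icc_right_eq_Icc_add_one (by omega : 1 ≤ n + 1), Finset.filter_insert]
  split_ifs with hsm
  · rw [Finset.sum_insert (by simp)]
    refine (norm_add_le _ _).trans ?_
    rw [add_comm]
    refine add_le_add le_rfl ?_
    rw [norm_mul]
    have h1 : ‖complMul (omegaT τ) (n + 1)‖ ≤ 1 :=
      norm_complMul_le_one (fun p hp ↦ (norm_omegaT τ hp.pos).le) _
    have h2 : ‖(((n + 1 : ℕ) : ℂ)) ^ (-(((1 : ℝ)) : ℂ))‖ = 1 / (n + 1) := by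
      push_cast
      rw [Complex.cpow_neg_one, norm_inv]
      have : ‖((n : ℂ) + 1)‖ = (n : ℝ) + 1 := by
        rw [show (n : ℂ) + 1 = ((n + 1 : ℕ) : ℂ) by push_cast; ring, Complex.norm_natCast]; push_cast; ring
      rw [this, one_div]
    calc ‖complMul (omegaT τ) (n + 1)‖ * ‖(((n + 1 : ℕ) : ℂ)) ^ (-(((1 : ℝ)) : ℂ))‖ ≤ 1 * (1 / (n + 1)) := by
          rw [h2]; exact mul_le_mul_of_nonneg_right h1 (by positivity)
      _ = 1 / (n + 1) := one_mul _
  · have : (0 : ℝ) ≤ 1 / (n + 1) := by positivity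
    linarith

/-- **`‖B‖` drifts by at most `(N' − N)/(N + 1)`** between `N` and `N' ≥ N`. [folklore] -/
theorem norm_BT_le_of_le (τ : ℝ) (P N : ℕ) : ∀ d : ℕ, ‖BT τ P (N + d)‖ ≤ ‖BT τ P N‖ + d / (N + 1)
  | 0 => by simp
  | d + 1 => by
    have ih := norm_BT_le_of_le τ P N d
    have h := norm_BT_succ_le τ P (N + d)
    rw [show N + (d + 1) = N + d + 1 by ring]
    have hle : (1 : ℝ) / ((N + d : ℕ) + 1) ≤ 1 / (N + 1) := by
      refine one_div_le_one_div_of_le (by positivity) ?_; push_cast; linarith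
    push_cast at ih h hle ⊢
    have e : ((d : ℝ) + 1) / (N + 1) = d / (N + 1) + 1 / (N + 1) := by ring
    rw [e]
    linarith

/-- At most one free prime divides `n + 1 < Q²`. [folklore] -/
theorem card_free_dvd_le_one {P Q n : ℕ} (hnb : ∀ r, P < r → r < Q → ¬ r.Prime) (hn : n + 1 < Q * Q) :
    ((freePrimes n (Sset P)).filter (fun p ↦ p ∣ n + 1)).card ≤ 1 := by
  refine Finset.card_le_one.2 fun p hp p' hp' ↦ ?_
  rw [Finset.mem_filter] at hp hp'
  by_contra hne
  have hQp := Q_le_of_free hnb hp.1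
  have hQp' := Q_le_of_free hnb hp'.1
  have hpr := (mem_freePrimes_Sset.1 hp.1).1
  have hpr' := (mem_freePrimes_Sset.1 hp'.1).1
  have hcop : Nat.Coprime p p' := (Nat.coprime_primes hpr hpr').2 hne
  have hdvd : p * p' ∣ n + 1 := hcop.mul_dvd_of_dvd_of_dvd hp.2 hp'.2
  have hle : p * p' ≤ n + 1 := Nat.le_of_dvd (by omega) hdvd
  have : Q * Q ≤ p * p' := Nat.mul_le_mul hQp hQp'
  omega

/-- One step of `R`: `R(n+1) ≥ R(n) − 1/(n+1)` on a block. [folklore] -/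
theorem RT_succ_ge (τ : ℝ) {P Q n : ℕ} (hnb : ∀ r, P < r → r < Q → ¬ r.Prime) (hn : n + 1 < Q * Q) :
    RT τ P n - 1 / (n + 1) ≤ RT τ P (n + 1) := by
  set s := 1 + τ * I with hs
  have hsre : s.re = 1 := by simp [hs]
  rw [RT_eq, RT_eq]
  -- restrict the new sum to the old free primes
  have hsub : freePrimes n (Sset P) ⊆ freePrimes (n + 1) (Sset P) := by
    intro p hp
    rw [mem_freePrimes_Sset] at hp ⊢
    exact ⟨hp.1, hp.2.1, by omega⟩
  have hrest : ∑ p ∈ freePrimes n (Sset P), ‖powSum s ((n + 1) / p)‖ / p ≤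
      ∑ p ∈ freePrimes (n + 1) (Sset P), ‖powSum s ((n + 1) / p)‖ / p :=
    Finset.sum_le_sum_of_subset_of_nonneg hsub fun p _ _ ↦ by positivity
  refine le_trans ?_ hrest
  -- termwise: `‖S((n+1)/p)‖/p ≥ ‖S(n/p)‖/p − [p ∣ n+1]/(n+1)`
  have hterm : ∀ p ∈ freePrimes n (Sset P), ‖powSum s (n / p)‖ / p - (if p ∣ n + 1 then 1 / ((n : ℝ) + 1) else 0) ≤
      ‖powSum s ((n + 1) / p)‖ / p := by
    intro p hp
    have hpr := (mem_freePrimes_Sset.1 hp).1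
    have hp0 : (0 : ℝ) < p := by exact_mod_cast hpr.pos
    split_ifs with hdvd
    · -- `(n+1)/p = n/p + 1`
      obtain ⟨m, hm⟩ := hdvd
      obtain ⟨k, rfl⟩ : ∃ k, m = k + 1 := by
        rcases Nat.eq_zero_or_pos m with h0 | h0
        · rw [h0, mul_zero] at hm; omega
        · exact ⟨m - 1, by omega⟩
      have hp1 := hpr.one_lt
      have hn : n = (p - 1) + p * k := by
        have : n + 1 = p * k + p := by rw [hm]; ring
        omega
      have hdiv1 : (n + 1) / p = k + 1 := by rw [hm]; exact Nat.mul_div_cancel_left (k + 1) hpr.pos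
      have hdiv0 : n / p = k := by
        rw [hn, Nat.add_mul_div_left _ _ hpr.pos, Nat.div_eq_of_lt (by omega)]
        simp
      rw [hdiv1, hdiv0]
      have hsucc : powSum s (k + 1) = powSum s k + npow s ((k + 1 : ℕ) : ℝ) := powSum_succ s k
      have hk0R : (0 : ℝ) < ((k + 1 : ℕ) : ℝ) := by positivity
      have hnorm : ‖npow s ((k + 1 : ℕ) : ℝ)‖ = 1 / ((k + 1 : ℕ) : ℝ) := by
        rw [norm_npow_of_re_eq_one hsre hk0R, one_div]
      have hmp : (((k + 1 : ℕ) : ℝ)) * p = n + 1 := by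
        have : ((n + 1 : ℕ) : ℝ) = ((p * (k + 1) : ℕ) : ℝ) := by rw [hm]
        push_cast at this ⊢; linarith
      have htri : ‖powSum s k‖ ≤ ‖powSum s (k + 1)‖ + 1 / ((k + 1 : ℕ) : ℝ) := by
        rw [hsucc]
        have := norm_sub_le (powSum s k + npow s ((k + 1 : ℕ) : ℝ)) (npow s ((k + 1 : ℕ) : ℝ))
        simp only [add_sub_cancel_right] at this
        rw [hnorm] at this
        exact this
      rw [sub_le_iff_le_add, div_add_div _ _ hp0.ne' (by positivity), div_le_div_iff₀ hp0 (by positivity)]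
      have e : (1 : ℝ) / ((k + 1 : ℕ) : ℝ) = p / (n + 1) := by
        rw [div_eq_div_iff hk0R.ne' (by positivity)]; linarith
      rw [e] at htri
      have h3 : ‖powSum s k‖ * (n + 1) ≤ ‖powSum s (k + 1)‖ * (n + 1) + p := by
        have := mul_le_mul_of_nonneg_right htri (show (0 : ℝ) ≤ n + 1 by positivity)
        rwa [add_mul, div_mul_cancel₀ _ (by positivity : (n : ℝ) + 1 ≠ 0)] at this
      nlinarith
    · rw [Nat.succ_div_of_not_dvd hdvd, sub_zero]
  have hsum := Finset.sum_le_sum hterm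
  rw [Finset.sum_sub_distrib] at hsum
  refine le_trans ?_ hsum
  refine sub_le_sub_left ?_ _
  -- `∑ [p ∣ n+1]/(n+1) ≤ 1/(n+1)`
  rw [Finset.sum_ite, Finset.sum_const_zero, add_zero, Finset.sum_const, nsmul_eq_mul]
  have hcard := card_free_dvd_le_one hnb hn
  have hc : (((freePrimes n (Sset P)).filter (fun p ↦ p ∣ n + 1)).card : ℝ) ≤ 1 := by exact_mod_cast hcard
  have h0 : (0 : ℝ) ≤ 1 / ((n : ℝ) + 1) := by positivity
  nlinarith

/-- **`R` drifts down by at most `(N' − N)/(N + 1)`** between `N` and `N' = N + d < Q²`. [folklore] -/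
theorem RT_ge_of_le (τ : ℝ) {P Q N : ℕ} (hnb : ∀ r, P < r → r < Q → ¬ r.Prime) :
    ∀ d : ℕ, N + d < Q * Q → RT τ P N - d / (N + 1) ≤ RT τ P (N + d)
  | 0, _ => by simp
  | d + 1, hd => by
    have ih := RT_ge_of_le τ hnb (N := N) d (by omega)
    have h := RT_succ_ge τ hnb (n := N + d) (by rw [show N + d + 1 = N + (d + 1) by ring]; exact hd)
    rw [show N + (d + 1) = N + d + 1 by ring]
    have hle : (1 : ℝ) / ((N + d : ℕ) + 1) ≤ 1 / (N + 1) := by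
      refine one_div_le_one_div_of_le (by positivity) ?_; push_cast; linarith
    push_cast at ih h hle ⊢
    have e : ((d : ℝ) + 1) / (N + 1) = d / (N + 1) + 1 / (N + 1) := by ring
    rw [e]
    linarith

/-- **The side bound**: for a free prime `p` of `N < Q²`, `‖c_p(1)‖ ≤ (1 + log Q)/Q`. [folklore] -/
theorem norm_bigCoeff_le_side (τ : ℝ) {P Q N p : ℕ} (hnb : ∀ r, P < r → r < Q → ¬ r.Prime)
    (hN : N < Q * Q) (hQ : 1 ≤ Q) (hp : p ∈ freePrimes N (Sset P)) :
    ‖bigCoeff N (omegaT τ) p 1‖ ≤ (1 + Real.log Q) / Q := by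
  obtain ⟨hpr, _, hpN⟩ := mem_freePrimes_Sset.1 hp
  have hQp := Q_le_of_free hnb hp
  have hp0 : (0 : ℝ) < p := by exact_mod_cast hpr.pos
  have hQ0 : (0 : ℝ) < Q := by exact_mod_cast hQ
  rw [norm_bigCoeff_T τ N hpr.pos]
  have h1 : ‖powSum (1 + τ * I) (N / p)‖ ≤ 1 + Real.log ((N / p : ℕ) : ℝ) :=
    norm_powSum_le_one_add_log (by simp) _
  have hm : (N / p : ℕ) < Q := by
    refine Nat.div_lt_of_lt_mul ?_
    calc N < Q * Q := hN
      _ ≤ p * Q := Nat.mul_le_mul_right Q hQp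
  have hlog : Real.log ((N / p : ℕ) : ℝ) ≤ Real.log Q := by
    rcases Nat.eq_zero_or_pos (N / p) with h0 | h0
    · rw [h0]; simp; exact Real.log_nonneg (by exact_mod_cast hQ)
    · exact Real.log_le_log (by exact_mod_cast h0) (by exact_mod_cast hm.le)
  have hlog0 : 0 ≤ Real.log ((N / p : ℕ) : ℝ) := Real.log_natCast_nonneg _
  calc ‖powSum (1 + τ * I) (N / p)‖ / p ≤ (1 + Real.log ((N / p : ℕ) : ℝ)) / p :=
        div_le_div_of_nonneg_right h1 hp0.le
    _ ≤ (1 + Real.log Q) / Q := div_le_div₀ (by positivity) (by linarith) hQ0 (by exact_mod_cast hQp)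

/-! ## Inclusion properties of the checker -/

/-- `npow (iτ) k = e^{−iτ log k}`. [folklore] -/
theorem npow_tauI_eq (τ : ℝ) (k : ℝ) : npow (τ * I) k = Complex.exp (-((τ * Real.log k : ℝ) : ℂ) * I) := by
  unfold npow; congr 1; push_cast; ring

/-- `npow s k = e^{−iτ log k} · k⁻¹` (`k > 0`). [folklore] -/
theorem npow_sB_eq (a : ℕ) {k : ℝ} (hk : 0 < k) :
    npow (sB a) k = Complex.exp (-((tauB a * Real.log k : ℝ) : ℂ) * I) * ((k⁻¹ : ℝ) : ℂ) := by
  rw [sB, npow_one_add _ hk, npow_tauI_eq]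

/-- **`phase` encloses `e^{−iτ log k}`.** [folklore] -/
theorem phase_spec {piI : MI} (hpi : MI.mem S Real.pi piI) {a k : ℕ} {E : MC} (h : phase piI a k = some E) :
    MC.mem S (Complex.exp (-((tauB a * Real.log k : ℝ) : ℂ) * I)) E := by
  unfold phase at h
  split at h
  · simp at h
  rename_i Lk hLk
  have hlog := MI.mem_logNat S_pos hLk
  have hθ : MI.mem S (tauB a * Real.log k) ((Lk.mulInt a).divNat 1000) := by
    have := MI.mem_divNat (MI.mem_mulInt hlog a) (by norm_num : 0 < 1000)
    convert this using 1
    unfold tauB; push_cast; ring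
  exact mem_expNegI hpi h hθ

/-- `e^{−iτ log k}/k ∈ E/k` is `npow s k`. [folklore] -/
theorem mem_npow_of_phase {a k : ℕ} (hk : 0 < k) {E : MC}
    (hE : MC.mem S (Complex.exp (-((tauB a * Real.log k : ℝ) : ℂ) * I)) E) :
    MC.mem S (npow (sB a) k) (E.divNat k) := by
  have := MC.mem_divNat hE hk
  convert this using 1
  rw [npow_sB_eq a (by exact_mod_cast hk)]
  push_cast
  rw [div_eq_mul_inv]

/-- **The table of `S(m)`.** [folklore] -/
theorem tableList_spec {piI : MI} (hpi : MI.mem S Real.pi piI) (a : ℕ) :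
    ∀ (n : ℕ) {l : List MC}, tableList piI a n = some l →
      l.length = n ∧ ∀ (m : ℕ) (B : MC), l[m]? = some B → MC.mem S (powSum (sB a) m) B
  | 0, l, h => by
    simp only [tableList, Option.some.injEq] at h
    subst h; simp
  | 1, l, h => by
    simp only [tableList, Option.some.injEq] at h
    subst h
    refine ⟨rfl, ?_⟩
    intro m B hB
    have hm : m = 0 := by
      have : m < 1 := by simpa using (List.getElem?_eq_some_iff.1 hB).1
      omega
    subst hm
    simp at hB
    subst hB
    have : powSum (sB a) 0 = ((0 : ℤ) : ℂ) := by simp [powSum]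
    rw [this]; exact MC.mem_ofInt S 0
  | n + 2, l, h => by
    simp only [tableList] at h
    split at h
    · rename_i l' E hl' hE
      split at h
      · rename_i prev hprev
        simp only [Option.some.injEq] at h
        subst h
        obtain ⟨hlen, hmem⟩ := tableList_spec hpi a (n + 1) hl'
        refine ⟨by simp [hlen], ?_⟩
        intro m B hmB
        rcases Nat.lt_or_ge m (n + 1) with hm | hm
        · rw [List.getElem?_append_left (by rw [hlen]; exact hm)] at hmB
          exact hmem m B hmB
        · rw [List.getElem?_append_right (by rw [hlen]; exact hm)] at hmB
          have hmn : m = n + 1 := by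
            have : (([prev.add (E.divNat (n + 1))] : List MC)[m - l'.length]?).isSome := by rw [hmB]; rfl
            simp at this; omega
          subst hmn
          simp [hlen] at hmB
          subst hmB
          have h1 := hmem n prev hprev
          have h2 := mem_npow_of_phase (a := a) (by omega : 0 < n + 1) (phase_spec hpi hE)
          rw [powSum_succ]
          push_cast at h2 ⊢
          exact MC.mem_add h1 h2
      · simp at h
    · simp at h

/-- **The table array.** [folklore] -/
theorem table_spec {piI : MI} (hpi : MI.mem S Real.pi piI) {a : ℕ} {tbl : Array MC} (h : table piI a = some tbl) :
    (∀ (m : ℕ) (B : MC), tbl[m]? = some B → MC.mem S (powSum (sB a) m) B) ∧ tbl.size = K0 + 1 := by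
  obtain ⟨l, hl, rfl⟩ := Option.map_eq_some_iff.1 h
  obtain ⟨hlen, hmem⟩ := tableList_spec hpi a (K0 + 1) hl
  refine ⟨fun m B hB ↦ hmem m B ?_, by simp [hlen]⟩
  simpa using hB

/-- **`powIntBox` encloses `∫_1^x t^{-s} dt`.** [folklore] -/
theorem powIntBox_spec {a : ℕ} (ha : 0 < a) {x : ℝ} (hx : 1 ≤ x) {E : MC}
    (hE : MC.mem S (Complex.exp (-((tauB a * Real.log x : ℝ) : ℂ) * I)) E) :
    MC.mem S (powInt (sB a) x) (powIntBox a E) := by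
  have h := MC.mem_divNat (MC.mem_mulInt (MC.mem_mulNegI (MC.mem_sub (MC.mem_ofInt S 1) hE)) 1000) ha
  unfold powIntBox
  convert h using 1
  rw [powInt_eq (sB_ne_one ha) hx, sB_sub_one, npow_tauI_eq]
  have hτ : (tauB a : ℂ) ≠ 0 := Complex.ofReal_ne_zero.2 (tauB_pos ha).ne'
  have ha' : ((a : ℕ) : ℂ) ≠ 0 := by exact_mod_cast ha.ne'
  rw [div_eq_div_iff (mul_ne_zero hτ Complex.I_ne_zero) ha']
  unfold tauB
  push_cast
  field_simp
  ring_nf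
  rw [Complex.I_sq]
  ring

/-- **`c0Box` encloses the Euler–Maclaurin constant `c₀(s)`.** [folklore] -/
theorem c0Box_spec {piI : MI} (hpi : MI.mem S Real.pi piI) {a : ℕ} (ha0 : 0 < a) (ha : a ≤ 1100)
    {tbl : Array MC} (htbl : ∀ (m : ℕ) (B : MC), tbl[m]? = some B → MC.mem S (powSum (sB a) m) B)
    {c0 : MC} (h : c0Box piI a tbl = some c0) : MC.mem S (emConst (sB a)) c0 := by
  unfold c0Box at h
  split at h
  · rename_i SK EK hSK hEK
    simp only [Option.some.injEq] at h
    subst h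
    have hK : (1 : ℝ) ≤ K0 := by norm_num [K0]
    have hK0 : 0 < K0 := by norm_num [K0]
    have hE := phase_spec hpi hEK
    have h1 := htbl _ _ hSK
    have h2 := powIntBox_spec ha0 hK hE
    have h3 : MC.mem S (npow (sB a) K0 / 2) (EK.divNat (2 * K0)) := by
      have := MC.mem_divNat hE (by norm_num [K0] : 0 < 2 * K0)
      convert this using 1
      rw [npow_sB_eq a (by exact_mod_cast hK0)]
      push_cast
      field_simp
    have hv := MC.mem_sub (MC.mem_sub h1 h2) h3
    refine MC.mem_widen hv ?_
    have hb := norm_emConst_sub_le (sB_re a) (K := K0) (by norm_num [K0])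
    have h4 := norm_sB_mul_le ha
    refine le_cdiv_of_le_div (by norm_num [K0]) ?_
    push_cast
    rw [le_div_iff₀ (by norm_num [K0])]
    have hK2 : (0 : ℝ) < (K0 : ℝ) ^ 2 := by positivity
    calc ‖emConst (sB a) - (powSum (sB a) K0 - powInt (sB a) K0 - npow (sB a) K0 / 2)‖ * S * (4 * (K0 : ℝ) ^ 2)
        ≤ ‖sB a * (sB a + 1)‖ / (16 * (K0 : ℝ) ^ 2) * S * (4 * (K0 : ℝ) ^ 2) := by gcongr
      _ = ‖sB a * (sB a + 1)‖ / 4 * S := by field_simp; ring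
      _ ≤ 4 / 4 * S := by gcongr
      _ = S := by ring
  · simp at h

/-- **`bigSBox` encloses `S(N)`** (`N ≥ 1`). [folklore] -/
theorem bigSBox_spec {piI : MI} (hpi : MI.mem S Real.pi piI) {a : ℕ} (ha0 : 0 < a) (ha : a ≤ 1100)
    {c0 : MC} (hc0 : MC.mem S (emConst (sB a)) c0) {N : ℕ} (hN : 1 ≤ N) {B : MC}
    (h : bigSBox piI a c0 N = some B) : MC.mem S (powSum (sB a) N) B := by
  unfold bigSBox at h
  split at h
  · simp at h
  rename_i EN hEN
  simp only [Option.some.injEq] at h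
  subst h
  have hN1 : (1 : ℝ) ≤ N := by exact_mod_cast hN
  have hN0 : (0 : ℝ) < N := by linarith
  have hE := phase_spec hpi hEN
  have h2 := powIntBox_spec ha0 hN1 hE
  have h3 : MC.mem S (npow (sB a) N / 2) (EN.divNat (2 * N)) := by
    have := MC.mem_divNat hE (by omega : 0 < 2 * N)
    convert this using 1
    rw [npow_sB_eq a hN0]
    push_cast
    field_simp
  have hv := MC.mem_add (MC.mem_add h2 hc0) h3
  rw [powSum_eq_powInt_add (sB_re a) hN]
  refine MC.mem_widen hv ?_
  rw [show powInt (sB a) N + emConst (sB a) + npow (sB a) N / 2 + emTail (sB a) N -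
      (powInt (sB a) N + emConst (sB a) + npow (sB a) N / 2) = emTail (sB a) N by ring]
  have hb := norm_emTail_le (sB_re a) hN
  have h4 := norm_sB_mul_le ha
  refine le_cdiv_of_le_div (by positivity) ?_
  push_cast
  rw [le_div_iff₀ (by positivity)]
  calc ‖emTail (sB a) N‖ * S * (4 * (N : ℝ) ^ 2) ≤ ‖sB a * (sB a + 1)‖ / (16 * (N : ℝ) ^ 2) * S * (4 * (N : ℝ) ^ 2) := by
        gcongr
    _ = ‖sB a * (sB a + 1)‖ / 4 * S := by field_simp; ring
    _ ≤ 4 / 4 * S := by gcongr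
    _ = S := by ring

/-- **The prime sums** (accumulator invariant). [folklore] -/
theorem primeSums_spec {piI : MI} (hpi : MI.mem S Real.pi piI) {a P N : ℕ} {tbl : Array MC}
    (htbl : ∀ (m : ℕ) (B : MC), tbl[m]? = some B → MC.mem S (powSum (sB a) m) B) :
    ∀ (l : List ℕ) {accB : MC} {accR : ℤ} {zB : ℂ} {zR : ℝ}, (∀ p ∈ l, p.Prime) →
      MC.mem S zB accB → (accR : ℝ) ≤ zR * S →
      ∀ {out : MC × ℤ}, primeSums piI a P N tbl l accB accR = some out →
        MC.mem S (zB + ((l.filter (fun p ↦ decide (P < p ∧ p ≤ N))).map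
            (fun p : ℕ ↦ npow (sB a) p * powSum (sB a) (N / p))).sum) out.1 ∧
        (out.2 : ℝ) ≤ (zR + ((l.filter (fun p ↦ decide (P < p ∧ p ≤ N))).map
            (fun p : ℕ ↦ ‖powSum (sB a) (N / p)‖ / (p : ℝ))).sum) * S
  | [], accB, accR, zB, zR, _, hB, hR, out, h => by
    simp only [primeSums, Option.some.injEq] at h
    subst h
    simpa using And.intro hB hR
  | p :: ps, accB, accR, zB, zR, hprime, hB, hR, out, h => by
    have hp : p.Prime := hprime p (by simp)
    have hps : ∀ q ∈ ps, q.Prime := fun q hq ↦ hprime q (by simp [hq])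
    simp only [primeSums] at h
    by_cases hc : P < p ∧ p ≤ N
    · rw [if_pos hc] at h
      split at h
      · rename_i Sm Ep hSm hEp
        have hSm' := htbl _ _ hSm
        have hEp' := phase_spec hpi hEp
        have hterm : MC.mem S (npow (sB a) p * powSum (sB a) (N / p)) ((MC.mul S Ep Sm).divNat p) := by
          have := MC.mem_divNat (MC.mem_mul S_pos hEp' hSm') hp.pos
          convert this using 1
          rw [npow_sB_eq a (by exact_mod_cast hp.pos)]
          push_cast
          field_simp
        have hR' : ((accR + (normLo Sm : ℤ) / (p : ℤ) : ℤ) : ℝ) ≤ (zR + ‖powSum (sB a) (N / p)‖ / p) * S := by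
          have h1 := normLo_le_norm hSm'
          have hp0 : (0 : ℝ) < p := by exact_mod_cast hp.pos
          have h2 : ((((normLo Sm : ℕ) : ℤ) / (p : ℤ) : ℤ) : ℝ) ≤ ‖powSum (sB a) (N / p)‖ / p * S := by
            refine fdiv_le_of_le_mul (by exact_mod_cast hp.pos) ?_
            push_cast
            rw [div_mul_eq_mul_div, div_mul_cancel₀ _ hp0.ne']
            exact h1
          push_cast at h2 ⊢
          rw [add_mul]
          exact add_le_add hR h2
        have ih := primeSums_spec hpi htbl ps hps (MC.mem_add hB hterm) hR' h
        rw [List.filter_cons_of_pos (by simpa using hc)]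
        simp only [List.map_cons, List.sum_cons]
        rw [← add_assoc, ← add_assoc]
        exact ih
      · simp at h
    · rw [if_neg hc] at h
      have ih := primeSums_spec hpi htbl ps hps hB hR h
      rw [List.filter_cons_of_neg (by simpa using hc)]
      exact ih

/-- The prime list is duplicate-free and consists of primes. [folklore] -/
theorem primesUpTo_nodup (H : ℕ) : (primesUpTo H).Nodup := (List.nodup_range).filter _

/-- [folklore] -/
theorem prime_of_mem_primesUpTo {H p : ℕ} (h : p ∈ primesUpTo H) : p.Prime := by
  unfold primesUpTo at h
  rw [List.mem_filter] at h
  exact of_decide_eq_true h.2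

/-- **From the filtered prime list to the free primes.** [folklore] -/
theorem sum_filter_primesUpTo {M : Type*} [AddCommMonoid M] {H P N : ℕ} (hN : N ≤ H) (f : ℕ → M) :
    (((primesUpTo H).filter (fun p ↦ decide (P < p ∧ p ≤ N))).map f).sum = ∑ p ∈ freePrimes N (Sset P), f p := by
  have hnd : ((primesUpTo H).filter (fun p ↦ decide (P < p ∧ p ≤ N))).Nodup := (primesUpTo_nodup H).filter _
  rw [← List.sum_toFinset f hnd]
  congr 1
  ext p
  rw [List.mem_toFinset, List.mem_filter, mem_freePrimes_Sset]
  unfold primesUpTo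
  rw [List.mem_filter, List.mem_range]
  simp only [decide_eq_true_eq]
  constructor
  · rintro ⟨⟨_, hp⟩, h1, h2⟩; exact ⟨hp, h1, h2⟩
  · rintro ⟨hp, h1, h2⟩; exact ⟨⟨by omega, hp⟩, h1, h2⟩

/-- **The checkpoint is sound**: `‖B(N)‖ S ≤ U` and `V ≤ R(N) S`. [folklore] -/
theorem checkpoint_spec {piI : MI} (hpi : MI.mem S Real.pi piI) {b : Blk} (ha0 : 0 < b.a) (ha : b.a ≤ 1100)
    (hnb : ∀ r, b.P < r → r < b.Q → ¬ r.Prime) {tbl : Array MC}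
    (htbl : ∀ (m : ℕ) (B : MC), tbl[m]? = some B → MC.mem S (powSum (sB b.a) m) B)
    {c0 : MC} (hc0 : MC.mem S (emConst (sB b.a)) c0) {H N : ℕ} (hNH : N ≤ H) (hN1 : 1 ≤ N)
    (hNQ : N < b.Q * b.Q) {U V : ℤ} (h : checkpoint piI b tbl c0 (primesUpTo H) N = some (U, V)) :
    ‖BT (tauB b.a) b.P N‖ * S ≤ U ∧ (V : ℝ) ≤ RT (tauB b.a) b.P N * S := by
  unfold checkpoint at h
  split at h
  · rename_i SN accB accR hSN hps
    simp only [Option.some.injEq, Prod.mk.injEq] at h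
    obtain ⟨rfl, rfl⟩ := h
    have h1 := bigSBox_spec hpi ha0 ha hc0 hN1 hSN
    have h0 : MC.mem S (0 : ℂ) (MC.ofInt S 0) := by simpa using MC.mem_ofInt S 0
    have h2 := primeSums_spec hpi htbl (primesUpTo H) (P := b.P) (N := N) (zB := 0) (zR := 0)
      (fun p hp ↦ prime_of_mem_primesUpTo hp) h0 (by simp) hps
    rw [zero_add, zero_add, sum_filter_primesUpTo hNH (fun p : ℕ ↦ npow (sB b.a) p * powSum (sB b.a) (N / p)),
      sum_filter_primesUpTo hNH (fun p : ℕ ↦ ‖powSum (sB b.a) (N / p)‖ / (p : ℝ))] at h2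
    have hB : BT (tauB b.a) b.P N = powSum (sB b.a) N -
        ∑ p ∈ freePrimes N (Sset b.P), npow (sB b.a) p * powSum (sB b.a) (N / p) := by
      rw [BT_eq (tauB b.a) hnb hNQ]; rfl
    have hR : RT (tauB b.a) b.P N = ∑ p ∈ freePrimes N (Sset b.P), ‖powSum (sB b.a) (N / p)‖ / p := by
      rw [RT_eq]; rfl
    constructor
    · rw [hB]
      exact_mod_cast norm_le_normHi (MC.mem_sub h1 h2.1)
    · rw [hR]; exact h2.2
  · simp at h

/-- **The side constant.** [folklore] -/
theorem sideQ_spec {Q : ℕ} (hQ : 1 ≤ Q) {sd : ℤ} (h : sideQ Q = some sd) :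
    2 * ((1 + Real.log Q) / Q) * S ≤ sd := by
  unfold sideQ at h
  split at h
  · simp at h
  rename_i LQ hLQ
  simp only [Option.some.injEq] at h
  subst h
  have hlog := MI.mem_logNat S_pos hLQ
  have hQ0 : (0 : ℝ) < Q := by exact_mod_cast hQ
  set mx : ℤ := max LQ.hi 0 with hmx
  have h1 : Real.log Q * S ≤ (mx : ℝ) := le_maxhi_of_mem hlog
  refine le_cdiv_of_le_div (by exact_mod_cast hQ) ?_
  push_cast
  rw [le_div_iff₀ hQ0]
  calc 2 * ((1 + Real.log Q) / Q) * S * Q = 2 * (S + Real.log Q * S) := by field_simp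
    _ ≤ 2 * (S + (mx : ℝ)) := by gcongr

/-- **The step rule.** [folklore] -/
theorem stepOf_spec {U V side : ℤ} {N h : ℕ} (hs : stepOf U V side N = some h) :
    U < V ∧ side < V ∧ 2 * (h : ℤ) * S < (V - U) * (N + 1) ∧ (h : ℤ) * S < (V - side) * (N + 1) := by
  unfold stepOf at hs
  split_ifs at hs with hc
  simp only [Option.some.injEq] at hs
  obtain ⟨hUV, hsV⟩ := hc
  have hS := S_posZ
  set A : ℤ := ((V - U) * (N + 1) - 1) / (2 * S) with hA
  set Bz : ℤ := ((V - side) * (N + 1) - 1) / S with hB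
  have hA0 : 0 ≤ A := Int.ediv_nonneg (by nlinarith) (by positivity)
  have hB0 : 0 ≤ Bz := Int.ediv_nonneg (by nlinarith) (by positivity)
  have hhA : (h : ℤ) ≤ A := by
    have : h ≤ A.toNat := by rw [← hs]; exact min_le_left _ _
    omega
  have hhB : (h : ℤ) ≤ Bz := by
    have : h ≤ Bz.toNat := by rw [← hs]; exact min_le_right _ _
    omega
  have hA1 : A * (2 * S) ≤ (V - U) * (N + 1) - 1 := Int.ediv_mul_le _ (by positivity)
  have hB1 : Bz * S ≤ (V - side) * (N + 1) - 1 := Int.ediv_mul_le _ (by positivity)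
  refine ⟨hUV, hsV, ?_, ?_⟩
  · nlinarith
  · nlinarith

/-- **The loop is sound**: every `N' ∈ [N, hi]` satisfies the two strict inequalities of the
criterion. [folklore] -/
theorem loop_spec {piI : MI} (hpi : MI.mem S Real.pi piI) {b : Blk} (ha0 : 0 < b.a) (ha : b.a ≤ 1100)
    (hnb : ∀ r, b.P < r → r < b.Q → ¬ r.Prime) (hQ : 1 ≤ b.Q) (hhiQ : b.hi < b.Q * b.Q) (hlo : 1 ≤ b.lo)
    {tbl : Array MC} (htbl : ∀ (m : ℕ) (B : MC), tbl[m]? = some B → MC.mem S (powSum (sB b.a) m) B)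
    {c0 : MC} (hc0 : MC.mem S (emConst (sB b.a)) c0) {H : ℕ} (hH : b.hi ≤ H) {side : ℤ}
    (hside : 2 * ((1 + Real.log b.Q) / b.Q) * S ≤ side) :
    ∀ (fuel N : ℕ), loop piI b tbl c0 (primesUpTo H) side fuel N = true → b.lo ≤ N →
      ∀ N', N ≤ N' → N' ≤ b.hi →
        ‖BT (tauB b.a) b.P N'‖ < RT (tauB b.a) b.P N' ∧
          ∀ p ∈ freePrimes N' (Sset b.P), 2 * ‖bigCoeff N' (omegaT (tauB b.a)) p 1‖ < RT (tauB b.a) b.P N' := by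
  intro fuel
  induction fuel with
  | zero => intro N h; simp [loop] at h
  | succ fuel ih =>
    intro N h hloN N' hNN' hN'hi
    simp only [loop] at h
    split at h
    · simp at h
    rename_i U V hcp
    split at h
    · simp at h
    rename_i hstep hst
    obtain ⟨hUV, hsV, h2h, h1h⟩ := stepOf_spec hst
    have hNhi : N ≤ b.hi := le_trans hNN' hN'hi
    obtain ⟨hBU, hVR⟩ := checkpoint_spec hpi ha0 ha hnb htbl hc0 (le_trans hNhi hH) (by omega)
      (lt_of_le_of_lt hNhi hhiQ) hcp
    -- the certified window `[N, N + h]`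
    have hwin : N' ≤ N + hstep →
        ‖BT (tauB b.a) b.P N'‖ < RT (tauB b.a) b.P N' ∧
          ∀ p ∈ freePrimes N' (Sset b.P), 2 * ‖bigCoeff N' (omegaT (tauB b.a)) p 1‖ < RT (tauB b.a) b.P N' := by
      intro hN'
      obtain ⟨d, rfl⟩ : ∃ d, N' = N + d := ⟨N' - N, by omega⟩
      have hd : d ≤ hstep := by omega
      have hB' := norm_BT_le_of_le (tauB b.a) b.P N d
      have hR' := RT_ge_of_le (tauB b.a) hnb (N := N) d (lt_of_le_of_lt hN'hi hhiQ)
      have hN1 : (0 : ℝ) < (N : ℝ) + 1 := by positivity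
      have hdR : (d : ℝ) / (N + 1) ≤ (hstep : ℝ) / (N + 1) :=
        div_le_div_of_nonneg_right (by exact_mod_cast hd) hN1.le
      have h2h' : 2 * (hstep : ℝ) * S < ((V : ℝ) - U) * (N + 1) := by exact_mod_cast h2h
      have h1h' : (hstep : ℝ) * S < ((V : ℝ) - side) * (N + 1) := by exact_mod_cast h1h
      -- `‖B(N')‖ < R(N')`
      have hkey : ‖BT (tauB b.a) b.P N‖ + hstep / (N + 1) < RT (tauB b.a) b.P N - hstep / (N + 1) := by
        have e1 : ‖BT (tauB b.a) b.P N‖ ≤ (U : ℝ) / S := by rw [le_div_iff₀ S_posR]; exact hBU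
        have e2 : (V : ℝ) / S ≤ RT (tauB b.a) b.P N := by rw [div_le_iff₀ S_posR]; exact hVR
        have e3 : (U : ℝ) / S + hstep / (N + 1) < (V : ℝ) / S - hstep / (N + 1) := by
          rw [div_add_div _ _ S_neR hN1.ne', div_sub_div _ _ S_neR hN1.ne', div_lt_div_iff_of_pos_right (mul_pos S_posR hN1)]
          nlinarith [mul_lt_mul_of_pos_right h2h' S_posR]
        linarith
      refine ⟨by linarith, ?_⟩
      intro p hp
      have hc := norm_bigCoeff_le_side (tauB b.a) hnb (lt_of_le_of_lt hN'hi hhiQ) hQ hp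
      have e2 : (V : ℝ) / S ≤ RT (tauB b.a) b.P N := by rw [div_le_iff₀ S_posR]; exact hVR
      have e4 : (side : ℝ) / S + hstep / (N + 1) < (V : ℝ) / S := by
        rw [div_add_div _ _ S_neR hN1.ne', div_lt_div_iff₀ (mul_pos S_posR hN1) S_posR]
        nlinarith [mul_lt_mul_of_pos_right h1h' S_posR]
      have e5 : 2 * ((1 + Real.log b.Q) / b.Q) ≤ (side : ℝ) / S := by rw [le_div_iff₀ S_posR]; exact hside
      linarith
    by_cases hfin : b.hi ≤ N + hstep
    · exact hwin (le_trans hN'hi hfin)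
    · rw [if_neg hfin] at h
      rcases Nat.lt_or_ge N' (N + hstep + 1) with hlt | hge
      · exact hwin (by omega)
      · exact ih (N + hstep + 1) h (by omega) N' hge hN'hi

/-- `noPrimeBetween` means what it says. [folklore] -/
theorem noPrimeBetween_spec {P Q : ℕ} (h : noPrimeBetween P Q = true) :
    ∀ r, P < r → r < Q → ¬ r.Prime := by
  intro r hPr hrQ hr
  unfold noPrimeBetween at h
  rw [List.all_eq_true] at h
  have := h r (by simp [List.mem_filter, hrQ, hPr])
  simp [hr] at this

/-- Unpacking `Blk.ok`. [folklore] -/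
theorem ok_spec {b : Blk} (h : b.ok = true) :
    b.P.Prime ∧ b.Q.Prime ∧ (∀ r, b.P < r → r < b.Q → ¬ r.Prime) ∧
      b.P * b.P ≤ b.lo ∧ b.hi < b.Q * b.Q ∧ b.lo ≤ b.hi ∧ K0 < b.lo ∧ 0 < b.a ∧ b.a ≤ 1100 ∧ 2 ≤ b.P := by
  unfold Blk.ok at h
  simp only [Bool.and_eq_true, decide_eq_true_eq] at h
  obtain ⟨⟨⟨hP, hQ⟩, hnb⟩, hrest⟩ := h
  exact ⟨hP, hQ, noPrimeBetween_spec hnb, hrest⟩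

/-- **The block check is sound.** [folklore] -/
theorem checkBlkWith_spec {piI : MI} (hpi : MI.mem S Real.pi piI) {H : ℕ} {b : Blk} (hH : b.hi ≤ H)
    (h : checkBlkWith piI (primesUpTo H) b = true) :
    ∀ N, b.lo ≤ N → N ≤ b.hi → ∃ s : ℂ, 1 < s.re ∧ zetaPartialSum N s = 0 := by
  intro N hlo hhi
  unfold checkBlkWith at h
  rw [Bool.and_eq_true] at h
  obtain ⟨hok, h⟩ := h
  obtain ⟨hP, hQ, hnb, hPlo, hhiQ, hlohi, hK0, ha0, ha, hP2⟩ := ok_spec hok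
  split at h
  · simp at h
  rename_i tbl htbl'
  obtain ⟨htbl, _⟩ := table_spec hpi htbl'
  split at h
  · rename_i c0 side hc0' hside'
    have hc0 := c0Box_spec hpi ha0 ha htbl hc0'
    have hside := sideQ_spec hQ.one_lt.le hside'
    have hmain := loop_spec hpi ha0 ha hnb hQ.one_lt.le hhiQ (by omega) htbl hc0 hH hside 64 b.lo h le_rfl N hlo hhi
    have hSall := hSall_of_block hnb (lt_of_le_of_lt hhi hhiQ)
    exact exists_zero_of_criterion hSall (ω := omegaT (tauB b.a)) (fun p _ hp ↦ norm_omegaT _ hp.pos)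
      hmain.1 hmain.2
  · simp at h

/-- **Soundness of the certified runs**: if `checkBlks H bs = true` then `ζ_N` has a zero with
`σ > 1` for every `N` in every block of `bs`. [folklore] -/
theorem exists_zero_of_checkBlks {H : ℕ} {bs : List Blk} (h : checkBlks H bs = true) :
    ∀ b ∈ bs, ∀ N, b.lo ≤ N → N ≤ b.hi → ∃ s : ℂ, 1 < s.re ∧ zetaPartialSum N s = 0 := by
  intro b hb N hlo hhi
  unfold checkBlks at h
  split at h
  · simp at h
  rename_i piI hpi'
  have hpi := MI.mem_pi S hpi'
  simp only [List.all_eq_true, Bool.and_eq_true, decide_eq_true_eq] at h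
  obtain ⟨hH, hchk⟩ := h b hb
  exact checkBlkWith_spec hpi hH hchk N hlo hhi

end LowCert

end TuranShift

end Literature.Barriers.RiemannHypothesis
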